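import Summits.CriticalPhenomena.Ising3DConformalLimit.Theorems.PrecisionLaplacianDirectCorrelationStableTailConverseSpineModulo
import Summits.CriticalPhenomena.Ising3DConformalLimit.Theorems.PrecisionLaplacianDirectCorrelationStableTailLevyContinuityTransfer
import HarnessLib

/-!
# Line `diffusive-branch-is-nonsaturation` — crux `PrecisionLaplacian.DirectCorrelationStableTail`
# (stmt-CriticalPhenomena-4799, route PrecisionLaplacian, rank 3) — THE CONVERSE TWO-POINT SPINE, unconditional in S6

Continuation lead prover-line-stmt-CriticalPhenomena-4799-c4-0 (2026-08-17).  Pure theorem file (no definitions, no `sorry`).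
The heavy lifting is `…ConverseSpineModulo.lean` (everything downstream of the Lévy-continuity stub S6 carried as a section
hypothesis); with S6 `stub_levyContinuityTransfer` landed (`…LevyContinuityTransfer.lean`) every statement becomes unconditional:

* `DirectCorrelationStableTail_of (hNS : NonSaturation 1342) (hR2 : IsingEuclidUpgradeR2RotInvPowerLaw 0634) : crux`
  (registered bookkeeping stub `stub_converseSpine` is the same implication);
* the headline equivalences are the tree theorems of `…ConverseSpineModulo.lean` applied to the landed S6, e.g.
  `directCorrelationStableTail_iff_twoPointLaw_and_nonSaturation_of_levyContinuity stub_levyContinuityTransfer hH :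
  crux ↔ (0634 ∧ 1342)`, `directCorrelationStableTail_decided_by_twoPointLaw_of_levyContinuity stub_levyContinuityTransfer hH hc hT :
  (1/2 < Δ → crux) ∧ (Δ ≤ 1/2 → ¬crux)`, `directCorrelationStableTail_iff_twoPointLaw_gt_half_of_levyContinuity stub_levyContinuityTransfer hH :
  crux ↔ ∃ Δ c, 1/2 < Δ ∧ 0 < c ∧ G|x|₂^{2Δ} → c` (the gate treats unconditional restatements as duplicates of these, `dedup.landed`).

Reading for the planner: under its own hypothesis `H`, crux r3 of route PrecisionLaplacian is EQUIVALENT to the sub-problem's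
central two-point item 0634 with exponent `Δ > 1/2` (equivalently 0634 ∧ 1342); it is not an independent open problem, and
item 0634 alone decides it.  References: see `…ConverseSpineModulo.lean`.
-/

noncomputable section

namespace Summit.CriticalPhenomena.Ising3DConformalLimit.Cruxes.DirectCorrelationStableTail.DiffusiveBranchIsNonsaturation

open MeasureTheory Filter Topology
open scoped BigOperators
open Literature.Probability.LatticeModels
open Summit.CriticalPhenomena.Ising3DConformalLimit.Theses

/-- **The converse two-point spine (unconditional in S6).**  NonSaturation (item 1342) and the isotropic pure power law of the
critical two-point function (item 0634) imply the crux `DirectCorrelationStableTail`, BY NAME. -/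
theorem DirectCorrelationStableTail_of (hNS : PerfectScreening.NonSaturation)
    (hR2 : IsingEuclidUpgrade.IsingEuclidUpgradeR2RotInvPowerLaw) :
    PrecisionLaplacian.DirectCorrelationStableTail :=
  DirectCorrelationStableTail_of_levyContinuity stub_levyContinuityTransfer hNS hR2

/-- **Registered bookkeeping stub `stub_converseSpine`** (the same implication, registered on the crux item). -/
theorem stub_converseSpine :
    PerfectScreening.NonSaturation → IsingEuclidUpgrade.IsingEuclidUpgradeR2RotInvPowerLaw →
    PrecisionLaplacian.DirectCorrelationStableTail :=
  fun hNS hR2 => DirectCorrelationStableTail_of hNS hR2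

end Summit.CriticalPhenomena.Ising3DConformalLimit.Cruxes.DirectCorrelationStableTail.DiffusiveBranchIsNonsaturation

end
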